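import Mathlib.Analysis.SpecialFunctions.Log.Basic
import Mathlib.Analysis.Complex.ExponentialBounds
import Mathlib.Data.Set.Finite.Basic
import HarnessLib

/-!
# Joshi, *Arithmetic Teichmüller Spaces IV* (arXiv:2403.10430v2) §6.6–§6.7 and Lemma 6.10.5: the prime sets `V^dst`,
# the ramification divisors `s`, `s^≤`, Lemmas 6.6.1 / 6.7.1 / 6.10.5 — TYPED over Joshi's tower of primes

Record file of the abc-iut cell, branch E «type Joshi's construction, test vs S» (rung LADDER-ABC:A2.E; seat abc-iut-E-t31, slot
T-31; plan/E/t31/INVENTORY.tsv; sibling file `Joshi/ATS4LocusUpperBounds.lean` = the real-number layer §6.8–§6.11). **No side is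
taken** on [IUTchIII] Cor. 3.12, on Joshi's claims, or on Mochizuki's report on them; the source is an unrefereed arXiv preprint
(«Preliminary version for comments»). TYPED ≠ PROVED ≠ ENDORSED: the paper's assertions are `Prop`-valued READING PREDICATES with
locators (render `HOME/lit/renders/Joshi-arxiv-2403.10430/pNNNN.txt`, «p.N l.M» = line M of PDF page N); nothing is asserted.

## What the source prints

* §6.6 (p.60 l.56–62): «Assume [J-III, §3.1, §3.3], Initial Theta Data … are in force. Suppose L_mod ⊆ L_tpd ⊆ M ⊆ L′ is an extension
  such that M/L_mod is Galois. Consider a subset of primes V^dst_M ⊂ V^non_M such that v ∈ V^dst_M, if and only if, v extends to a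
  prime of L′ which is ramified over ℚ.» Lemma 6.6.1 (p.60 l.63 – p.61 l.12): «TFAE (1) v ∈ V^dst_M. (2) v divides 30·ℓ or v ∈
  Supp(q_M + d_M). (3) The image of v ∈ V_{L_tpd} is contained in V^dst_{L_tpd}. In particular V^dst_M (and hence its image in
  V_{L_tpd}) is finite.» (Proof: «L′ ⊃ ℚ(ζ_{60·ℓ}). If v_M extends to some prime v of L′ which is ramified then v|d_M or v|q_M or
  v|2·3·5·ℓ.»)
* §6.7 (p.61 l.14–43, p.62 l.1–21): «Define V^dst_{L_mod} ⊂ V^non_{L_tpd} (resp. V^dst_ℚ ⊂ V^non_ℚ) to be the images of V^dst_{L_tpd}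
  in V_{L_mod} (resp. in V_ℚ). For a rational prime v_ℚ and for L* ∈ {L_mod, ℚ}, write V_{L*,v_ℚ} = V_{L*} ×_{V_ℚ} {v_ℚ}.» Lemma 6.7.1:
  «TFAE (1) v_ℚ ∈ V^dst_ℚ. (2) v_ℚ ramifies in L′. (3) v_ℚ divides 30·ℓ or v_ℚ is in the image of Supp(q_{L_tpd} + d_{L_tpd}). (4) v_ℚ
  divides 30·ℓ or v_ℚ is in the image of Supp(q_L + d_L).» «(6.7.2) s_{L*} = Σ_{v ∈ V^dst_{L*}} e_v·v. Then (6.7.3) deg(s_{L*}) ∈ ℝ_{≥0}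
  … (6.7.4) log(s_{L*}) = deg(s_{L*})/[L* : ℚ] ∈ ℝ_{≥0} be its normalized degree. … (6.7.5) ι_v = 1 if p_v ≤ e*_mod·ℓ, 0 otherwise.
  (6.7.6) s^≤_{L*} = Σ_{v ∈ V^dst_{L*}} (ι_v/p_v)·v … (6.7.7) deg(s^≤_{L*}), log(s^≤_{L*}) ∈ ℝ_{≥0} given by the formulae stated
  earlier.» (p.62 l.54–58: «log v = f_v·log(p_v)»; p.64 l.4–13 (6.8.12): «log(s_ℚ) = Σ_{p ∈ V^dst_ℚ} 1·log(p)».)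
* Lemma 6.10.5 (p.68 l.17–51): «Let (L′ ⊇) M ⊇ L ⊇ L_mod ⊇ ℚ, let u ∈ V_M and let u|w|v|p … Then log(e_u) ≤ −3 + 4·log(e*_mod·ℓ).»
  Proof: «(6.10.6) e^{M/ℚ}_u = e_{u|w}·e_{w|v}·e_{v|p} ≤ [L′ : L_mod]·e_mod ≤ [L′ : L]·[L : L_mod]·e_mod ≤ ℓ⁴·2·#GL₂(𝔽₂)·#GL₃(𝔽₂)·
  #GL₂(𝔽₂)·e_mod ≤ e*_mod·ℓ⁴. Hence (6.10.7) log(e_u) ≤ log(e*_mod·ℓ⁴) and as e ≤ 3 ≤ e*_mod … (6.10.8) log(e_u) ≤ −3 + 4·log(e*_mod·ℓ).»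
  («I found the assertions regarding this in [IUTchIV, (R1)–(R4), p.655] sufficiently unclear … So I felt the need to write out a
  proof», p.68 l.17–20.)

## What the typing records (located, not adjudicated)

The carrier `PrimeTowerDatum` holds the five prime sets of the tower `ℚ ⊆ L_mod ⊆ L_tpd ⊆ {L, M} ⊆ L′` with their restriction maps,
the set of primes of `L′` ramified over `ℚ` (finite: a number-field fact, carried as a field), the supports `Supp(q + d)`, and the
integers `e_v`, `f_v`, `p_v`, `d_mod`, `e*_mod`, `ℓ`. PROVED over the signature: `V^dst` is finite at every level (Lemma 6.6.1, last
sentence); §6.7's «images of V^dst_{L_tpd}» coincide with the direct definition («extends to a ramified prime of L′») at every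
level (`vdst_comp`); Lemma 6.6.1 (1) ⟹ (3) and Lemma 6.7.1 (1) ⟺ (2) are definitional; the degrees (6.7.3)/(6.7.7) are `≥ 0`; the
step (6.10.6) ⟹ Lemma 6.10.5 holds for `e*_mod ≥ 3`, `ℓ ≥ 1` (via `log 3 ≥ 1`). Reading predicates (never asserted): Lemma 6.6.1
(1) ⟺ (2) and (3) ⟹ (1), Lemma 6.7.1 (1) ⟺ (3) ⟺ (4), (6.10.6), Lemma 6.10.5. Locator notes for ref-x: print has «V^dst_{L_mod} ⊂
V^non_{L_tpd}» (read `V^non_{L_mod}`); (6.7.6) has coefficient `ι_v/p_v` where [IUTchIV] Step (iii) p.25 (our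
`Literature.IUT.LogVolume.Thm110Numerics.ProofData.logsLe`) has `ι/log(p_v)`; (6.10.6) prints `#GL₂(𝔽₂)·#GL₃(𝔽₂)·#GL₂(𝔽₂)` where
Lemma 4.1.2 (p.38 l.26–29) gives `Gal(L/L_mod) ↪ ℤ/2 × GL₂(𝔽₂) × GL₂(𝔽₃) × GL₂(𝔽₅)`. Nearest objects on OUR side (named only, E-PLAN
R14): `Literature.IUT.LogVolume.Thm110StepIII.StepIIIData` (`dst : Finset ℕ`, `logsQ = Σ_{q ∈ dst} log q`),
`Literature.IUT.LogVolume.ArakelovDivisors.deg/ndeg`, `Literature.IUT.LogVolume.RamificationInvariants.absRamificationIdx`.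
Merge-debts: T-30 (`e_mod`, `d_mod`, `e*_mod` of §4.1.1; Lemmas 6.3.2/6.3.3), T-26/T-27 (Supp(q), Supp(d), Thm 4.6.1).
[claim: Joshi2024ATS4, status: disputed] (unrefereed preprint).
-/

noncomputable section

open Finset

namespace Summit.ABC.IUTFork.Joshi.ATS4

/-! ## 1. The carrier: the tower of prime sets -/

/-- **Joshi's tower of primes** for §6.6–§6.7 and Lemma 6.10.5 ([J-IV] p.60 l.56–62, p.61 l.14–21, p.68 l.21–22): the sets of
nonarchimedean primes of `L′`, `M`, `L`, `L_tpd`, `L_mod` with the restriction («lies below») maps of the tower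
`ℚ ⊆ L_mod ⊆ L_tpd ⊆ M ⊆ L′`, `L_tpd ⊆ L ⊆ L′` (§4.1.2 (8)(9), §6.6, Lemma 6.10.5), the residue characteristic `p_v` of a prime of
`L_mod`, the primes of `L′` ramified over `ℚ` (a finite set — number-field fact, carried as data), the supports `Supp(q_M + d_M)`,
`Supp(q_{L_tpd} + d_{L_tpd})`, `Supp(q_L + d_L)` of the Tate and different divisors (§4.4, §4.1), the absolute ramification indices
`e_u` (`u` a prime of `M`) and `e_v`, residue degrees `f_v` (`v` a prime of `L_mod`), `d_mod = [L_mod : ℚ]`, `e*_mod` (§4.1.1 (2)(5))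
and the prime `ℓ`. SIGNATURE only; the paper's assertions are the predicates below. [claim: Joshi2024ATS4, status: disputed] -/
structure PrimeTowerDatum where
  /-- the nonarchimedean primes of `L′` -/ W : Type
  /-- the nonarchimedean primes of `M` -/ PM : Type
  /-- the nonarchimedean primes of `L` -/ PL : Type
  /-- the nonarchimedean primes of `L_tpd` -/ Ptpd : Type
  /-- the nonarchimedean primes of `L_mod` -/ Pmod : Type
  /-- `w ↦ w|_M` -/ resM : W → PM
  /-- `w ↦ w|_L` -/ resL : W → PL
  /-- `u ↦ u|_{L_tpd}` for primes of `M` -/ MtoTpd : PM → Ptpd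
  /-- `v ↦ v|_{L_tpd}` for primes of `L` -/ LtoTpd : PL → Ptpd
  /-- `v ↦ v|_{L_mod}` -/ tpdToMod : Ptpd → Pmod
  /-- the two routes `L′ → M → L_tpd` and `L′ → L → L_tpd` agree -/ res_comm : ∀ w, MtoTpd (resM w) = LtoTpd (resL w)
  /-- residue characteristic `p_v` of a prime `v` of `L_mod` (the rational prime below `v`) -/ char : Pmod → ℕ
  /-- the primes of `L′` ramified over `ℚ` -/ Ramified : Set W
  /-- only finitely many primes of the number field `L′` ramify over `ℚ` -/ ramified_finite : Ramified.Finite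
  /-- `Supp(q_M + d_M)` -/ suppM : Set PM
  /-- `Supp(q_{L_tpd} + d_{L_tpd})` -/ suppTpd : Set Ptpd
  /-- `Supp(q_L + d_L)` -/ suppL : Set PL
  /-- `e_u = e^{M/ℚ}_u`, the absolute ramification index of a prime `u` of `M` -/ eM : PM → ℕ
  /-- `e_v`, the absolute ramification index of a prime `v` of `L_mod` -/ eMod : Pmod → ℕ
  /-- `f_v`, the residue degree of a prime `v` of `L_mod` -/ fMod : Pmod → ℕ
  /-- `d_mod = [L_mod : ℚ]` -/ dmod : ℕ
  /-- `e*_mod = 2¹²·3³·5·e_mod` (§4.1.1 (5)) -/ estar : ℕ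
  /-- the prime `ℓ` -/ l : ℕ

namespace PrimeTowerDatum

variable (T : PrimeTowerDatum)

/-- Residue characteristic of a prime of `L_tpd`. [claim: Joshi2024ATS4, status: disputed] -/
def charTpd : T.Ptpd → ℕ := T.char ∘ T.tpdToMod

/-- Residue characteristic of a prime of `M`. [claim: Joshi2024ATS4, status: disputed] -/
def charM : T.PM → ℕ := T.charTpd ∘ T.MtoTpd

/-- Residue characteristic of a prime of `L`. [claim: Joshi2024ATS4, status: disputed] -/
def charL : T.PL → ℕ := T.charTpd ∘ T.LtoTpd

/-- Residue characteristic of a prime of `L′` («p_v is also the characteristic of the residue field of any prime of L′ lying over p»,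
p.65 l.31). [claim: Joshi2024ATS4, status: disputed] -/
def charW : T.W → ℕ := T.charM ∘ T.resM

/-! ## 2. §6.6–§6.7: the distinguished primes `V^dst` -/

/-- **§6.6, the definition of `V^dst` at any level of the tower** (p.60 l.58–62 «v ∈ V^dst_M, if and only if, v extends to a prime of
L′ which is ramified over ℚ»): along a restriction map `r : V_{L′} → V_X`, `V^dst_X` is the image under `r` of the ramified primes.
[claim: Joshi2024ATS4, status: disputed] -/
def vdst {X : Type} (r : T.W → X) : Set X := r '' T.Ramified

/-- `V^dst_M` (p.60 l.58–62). [claim: Joshi2024ATS4, status: disputed] -/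
def VdstM : Set T.PM := T.vdst T.resM

/-- `V^dst_{L_tpd}` (used in Lemma 6.6.1 (3) and §6.7; OUR READING: the §6.6 definition with `M := L_tpd`).
[claim: Joshi2024ATS4, status: disputed] -/
def VdstTpd : Set T.Ptpd := T.vdst (T.MtoTpd ∘ T.resM)

/-- `V^dst_{L_mod} :=` the image of `V^dst_{L_tpd}` in `V_{L_mod}` (p.61 l.14–19, as printed). [claim: Joshi2024ATS4, status: disputed] -/
def VdstMod : Set T.Pmod := T.tpdToMod '' T.VdstTpd

/-- `V^dst_ℚ :=` the image of `V^dst_{L_tpd}` in `V_ℚ` (p.61 l.14–19, as printed; rational primes as natural numbers).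
[claim: Joshi2024ATS4, status: disputed] -/
def VdstQ : Set ℕ := T.char '' T.VdstMod

/-- `V_{L*,v_ℚ} = V_{L*} ×_{V_ℚ} {v_ℚ}` (p.61 l.20–21): the primes of `L*` over the rational prime `v_ℚ`, for any level with residue
characteristic map `c`. [claim: Joshi2024ATS4, status: disputed] -/
def fibre {X : Type} (c : X → ℕ) (p : ℕ) : Set X := {x | c x = p}

/-- **Lemma 6.6.1, last sentence, at every level**: `V^dst` is finite (image of the finite set of ramified primes of `L′`). PROVED
over the signature. [claim: Joshi2024ATS4, status: disputed] -/
theorem vdst_finite {X : Type} (r : T.W → X) : (T.vdst r).Finite := T.ramified_finite.image r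

/-- **§6.7's «images» agree with §6.6's definition**: the image of `V^dst` along a further restriction `s` is `V^dst` of the composite
map. PROVED (so `V^dst_{L_mod}`, `V^dst_ℚ` are also «the primes below a ramified prime of L′»). [claim: Joshi2024ATS4, status: disputed] -/
theorem vdst_comp {X Y : Type} (r : T.W → X) (s : X → Y) : T.vdst (s ∘ r) = s '' T.vdst r :=
  Set.image_comp s r _

/-- `V^dst_{L_mod}` is `V^dst` of the composite restriction `L′ → L_mod`. PROVED. [claim: Joshi2024ATS4, status: disputed] -/
theorem vdstMod_eq : T.VdstMod = T.vdst (T.tpdToMod ∘ T.MtoTpd ∘ T.resM) :=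
  (T.vdst_comp _ _).symm

/-- `V^dst_ℚ` is the set of residue characteristics of the ramified primes of `L′`. PROVED. [claim: Joshi2024ATS4, status: disputed] -/
theorem vdstQ_eq : T.VdstQ = T.vdst T.charW := by
  unfold VdstQ; rw [vdstMod_eq]; exact (T.vdst_comp _ _).symm

/-- `V^dst_M`, `V^dst_{L_tpd}`, `V^dst_{L_mod}`, `V^dst_ℚ` are finite («In particular V^dst_M (and hence its image in V_{L_tpd}) is
finite», p.61 l.6–7). PROVED. [claim: Joshi2024ATS4, status: disputed] -/
theorem vdst_levels_finite : T.VdstM.Finite ∧ T.VdstTpd.Finite ∧ T.VdstMod.Finite ∧ T.VdstQ.Finite :=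
  ⟨T.vdst_finite _, T.vdst_finite _, by rw [vdstMod_eq]; exact T.vdst_finite _, by rw [vdstQ_eq]; exact T.vdst_finite _⟩

/-- «v divides 30·ℓ» for a prime `v` with residue characteristic `c v` (Lemma 6.6.1 (2), Lemma 6.7.1 (3)(4)): `p_v ∣ 30·ℓ`.
[claim: Joshi2024ATS4, status: disputed] -/
def DvdThirtyL {X : Type} (c : X → ℕ) (x : X) : Prop := c x ∣ 30 * T.l

/-- **Lemma 6.6.1 (1) ⟺ (2)** (p.61 l.1–3): «v ∈ V^dst_M ⟺ v divides 30·ℓ or v ∈ Supp(q_M + d_M)». READING PREDICATE; never asserted.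
[claim: Joshi2024ATS4, status: disputed] -/
@[claim "Joshi2024ATS4" "disputed"]
def Lem661₁₂ : Prop := ∀ v : T.PM, v ∈ T.VdstM ↔ (T.DvdThirtyL T.charM v ∨ v ∈ T.suppM)

/-- **Lemma 6.6.1 (1) ⟺ (3)** (p.61 l.1–5): «v ∈ V^dst_M ⟺ the image of v in V_{L_tpd} is contained in V^dst_{L_tpd}». READING PREDICATE
((1) ⟹ (3) is definitional, `vdstM_sub`; (3) ⟹ (1) is the printed content). [claim: Joshi2024ATS4, status: disputed] -/
@[claim "Joshi2024ATS4" "disputed"]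
def Lem661₁₃ : Prop := ∀ v : T.PM, v ∈ T.VdstM ↔ T.MtoTpd v ∈ T.VdstTpd

/-- Lemma 6.6.1 (1) ⟹ (3) holds over the signature: a prime of `M` below a ramified prime `w` of `L′` restricts to a prime of `L_tpd`
below `w`. PROVED. [claim: Joshi2024ATS4, status: disputed] -/
theorem vdstM_sub (v : T.PM) (h : v ∈ T.VdstM) : T.MtoTpd v ∈ T.VdstTpd := by
  obtain ⟨w, hw, rfl⟩ := h
  exact ⟨w, hw, rfl⟩

/-- «v_ℚ ramifies in L′» (Lemma 6.7.1 (2)): some prime of `L′` above `v_ℚ` is ramified over `ℚ`. [claim: Joshi2024ATS4, status: disputed] -/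
def RamifiesIn (p : ℕ) : Prop := ∃ w ∈ T.Ramified, T.charW w = p

/-- **Lemma 6.7.1 (1) ⟺ (2)** (p.61 l.26–28) holds over the signature once §6.7's «image» definition is unfolded (`vdstQ_eq`). PROVED.
[claim: Joshi2024ATS4, status: disputed] -/
theorem lem671_one_iff_two (p : ℕ) : p ∈ T.VdstQ ↔ T.RamifiesIn p := by
  rw [vdstQ_eq]; rfl

/-- **Lemma 6.7.1 (1) ⟺ (3)** (p.61 l.26–29): «v_ℚ ∈ V^dst_ℚ ⟺ v_ℚ divides 30·ℓ or v_ℚ is in the image of Supp(q_{L_tpd} + d_{L_tpd})».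
READING PREDICATE; never asserted. [claim: Joshi2024ATS4, status: disputed] -/
@[claim "Joshi2024ATS4" "disputed"]
def Lem671₁₃ : Prop := ∀ p : ℕ, p ∈ T.VdstQ ↔ (p ∣ 30 * T.l ∨ p ∈ T.charTpd '' T.suppTpd)

/-- **Lemma 6.7.1 (1) ⟺ (4)** (p.61 l.26–30): «v_ℚ ∈ V^dst_ℚ ⟺ v_ℚ divides 30·ℓ or v_ℚ is in the image of Supp(q_L + d_L)». READING
PREDICATE; never asserted. [claim: Joshi2024ATS4, status: disputed] -/
@[claim "Joshi2024ATS4" "disputed"]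
def Lem671₁₄ : Prop := ∀ p : ℕ, p ∈ T.VdstQ ↔ (p ∣ 30 * T.l ∨ p ∈ T.charL '' T.suppL)

/-! ## 3. §6.7: the ramification divisors `s_{L*}`, `s^≤_{L*}` for `L* ∈ {L_mod, ℚ}`, by their degrees -/

/-- `V^dst_{L_mod}` as a finite set (Lemma 6.6.1, finiteness — proved above). [claim: Joshi2024ATS4, status: disputed] -/
def vdstModFinset : Finset T.Pmod := (T.vdst_levels_finite.2.2.1).toFinset

/-- `V^dst_ℚ` as a finite set of rational primes. [claim: Joshi2024ATS4, status: disputed] -/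
def vdstQFinset : Finset ℕ := (T.vdst_levels_finite.2.2.2).toFinset

/-- Membership in the finite set `V^dst_ℚ` is membership in `V^dst_ℚ`. [folklore] -/
theorem mem_vdstQFinset (p : ℕ) : p ∈ T.vdstQFinset ↔ p ∈ T.VdstQ := Set.Finite.mem_toFinset _

/-- `log v = f_v·log(p_v)`, the log-cardinality of the residue field of a prime `v` of `L_mod` (p.62 l.56–58).
[claim: Joshi2024ATS4, status: disputed] -/
def logNormMod (v : T.Pmod) : ℝ := (T.fMod v : ℝ) * Real.log (T.char v)

/-- **(6.7.2)–(6.7.3) for `L* = L_mod`**: `deg(s_{L_mod}) = Σ_{v ∈ V^dst_{L_mod}} e_v·log v` (the degree of `s_{L_mod} = Σ e_v·v`).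
[claim: Joshi2024ATS4, status: disputed] -/
def degSMod : ℝ := ∑ v ∈ T.vdstModFinset, (T.eMod v : ℝ) * T.logNormMod v

/-- **(6.7.4) for `L* = L_mod`**: `log(s_{L_mod}) = deg(s_{L_mod})/[L_mod : ℚ]`. [claim: Joshi2024ATS4, status: disputed] -/
def logSMod : ℝ := T.degSMod / T.dmod

/-- The `v_ℚ`-component of `log(s_ℚ)` (p.62 l.59–64, (6.8.12) p.64 l.4–13 «log(s_ℚ) = Σ_{p ∈ V^dst_ℚ} 1·log(p)»): `log p` (over `ℚ`,
`e_p = f_p = 1` and `[ℚ : ℚ] = 1`). [claim: Joshi2024ATS4, status: disputed] -/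
def logSQAt (p : ℕ) : ℝ := Real.log p

/-- **(6.7.2)–(6.7.4) for `L* = ℚ`**: `log(s_ℚ) = deg(s_ℚ) = Σ_{p ∈ V^dst_ℚ} log p`. (Nearest on OUR side:
`Literature.IUT.LogVolume.Thm110StepIII.StepIIIData.logsQ`.) [claim: Joshi2024ATS4, status: disputed] -/
def logSQ : ℝ := ∑ p ∈ T.vdstQFinset, logSQAt p

/-- **(6.7.5)** `ι_v = 1` if `p_v ≤ e*_mod·ℓ`, `0` otherwise (p.62 l.1–6), as a function of the residue characteristic.
[claim: Joshi2024ATS4, status: disputed] -/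
def iota (p : ℕ) : ℝ := if p ≤ T.estar * T.l then 1 else 0

/-- The `v_ℚ`-component of `log(s^≤_ℚ)`: `(ι_p/p)·log p` ((6.7.6) AS PRINTED, coefficient `ι_v/p_v`; [IUTchIV] p.25 has `ι/log(p_v)`).
[claim: Joshi2024ATS4, status: disputed] -/
def logSleQAt (p : ℕ) : ℝ := T.iota p / p * Real.log p

/-- **(6.7.6)–(6.7.7) for `L* = ℚ`**: `log(s^≤_ℚ) = deg(s^≤_ℚ) = Σ_{p ∈ V^dst_ℚ} (ι_p/p)·log p`. [claim: Joshi2024ATS4, status: disputed] -/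
def logSleQ : ℝ := ∑ p ∈ T.vdstQFinset, T.logSleQAt p

/-- **(6.7.6)–(6.7.7) for `L* = L_mod`**: `deg(s^≤_{L_mod}) = Σ_{v ∈ V^dst_{L_mod}} (ι_v/p_v)·log v`. [claim: Joshi2024ATS4, status: disputed] -/
def degSleMod : ℝ := ∑ v ∈ T.vdstModFinset, T.iota (T.char v) / (T.char v) * T.logNormMod v

/-- `log v = f_v·log p_v ≥ 0`. [folklore] -/
theorem logNormMod_nonneg (v : T.Pmod) : 0 ≤ T.logNormMod v :=
  mul_nonneg (Nat.cast_nonneg _) (Real.log_natCast_nonneg _)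

/-- `0 ≤ ι_p ≤ 1`. [folklore] -/
theorem iota_nonneg (p : ℕ) : 0 ≤ T.iota p := by unfold iota; split_ifs <;> norm_num

/-- **(6.7.3), (6.7.7): the degrees are `≥ 0`** («deg(s_{L*}) ∈ ℝ_{≥0}», «deg(s^≤_{L*}), log(s^≤_{L*}) ∈ ℝ_{≥0}»). PROVED over the
signature. [claim: Joshi2024ATS4, status: disputed] -/
theorem degrees_nonneg : 0 ≤ T.degSMod ∧ 0 ≤ T.logSMod ∧ 0 ≤ T.logSQ ∧ 0 ≤ T.logSleQ ∧ 0 ≤ T.degSleMod := by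
  have h1 : 0 ≤ T.degSMod :=
    Finset.sum_nonneg fun v _ => mul_nonneg (Nat.cast_nonneg _) (T.logNormMod_nonneg v)
  refine ⟨h1, div_nonneg h1 (Nat.cast_nonneg _), Finset.sum_nonneg fun p _ => Real.log_natCast_nonneg _,
    Finset.sum_nonneg fun p _ => ?_, Finset.sum_nonneg fun v _ => ?_⟩
  · exact mul_nonneg (div_nonneg (T.iota_nonneg p) (Nat.cast_nonneg _)) (Real.log_natCast_nonneg _)
  · exact mul_nonneg (div_nonneg (T.iota_nonneg _) (Nat.cast_nonneg _)) (T.logNormMod_nonneg v)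

/-- `s^≤_ℚ ≤ s_ℚ` degreewise: `(ι_p/p)·log p ≤ log p` termwise (`ι_p ≤ 1 ≤ p` on primes; for `p = 0` both sides vanish). PROVED —
«s^≤ is supported on primes ≤ e*_mod·ℓ» (p.62 l.28) is the only use print makes of (6.7.6). [folklore] -/
theorem logSleQ_le_logSQ : T.logSleQ ≤ T.logSQ := by
  refine Finset.sum_le_sum fun p _ => ?_
  unfold logSleQAt logSQAt
  have hlog : 0 ≤ Real.log (p : ℝ) := Real.log_natCast_nonneg _
  have hc : T.iota p / p ≤ 1 := by
    rcases Nat.eq_zero_or_pos p with h0 | hp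
    · simp [h0]
    · rw [div_le_one (by exact_mod_cast hp)]
      have : (1 : ℝ) ≤ p := by exact_mod_cast hp
      unfold iota; split_ifs <;> linarith
  nlinarith

/-! ## 4. Lemma 6.10.5 and its step (6.10.6) -/

/-- **(6.10.6)** (p.68 l.33–40): «e^{M/ℚ}_u ≤ [L′ : L_mod]·e_mod ≤ … ≤ e*_mod·ℓ⁴» for every prime `u` of `M`. READING PREDICATE (rests on
Lemma 6.3.3, Lemma 6.3.2, §4.1.1 (4)(5) — slot T-30); never asserted. [claim: Joshi2024ATS4, status: disputed] -/
@[claim "Joshi2024ATS4" "disputed"]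
def Eq6106 : Prop := ∀ u : T.PM, (T.eM u : ℝ) ≤ (T.estar : ℝ) * (T.l : ℝ) ^ 4

/-- **Lemma 6.10.5** (p.68 l.21–24): «log(e_u) ≤ −3 + 4·log(e*_mod·ℓ)» for every prime `u` of `M`. READING PREDICATE (derived below
from (6.10.6)); never asserted. [claim: Joshi2024ATS4, status: disputed] -/
@[claim "Joshi2024ATS4" "disputed"]
def Lem6105 : Prop := ∀ u : T.PM, Real.log (T.eM u) ≤ -3 + 4 * Real.log ((T.estar : ℝ) * T.l)

/-- **(6.10.6) ⟹ Lemma 6.10.5** ((6.10.7)–(6.10.8), p.68 l.41–51: «as e ≤ 3 ≤ e*_mod so −3 + 4·log(e*_mod·ℓ) ≥ log(e*_mod·ℓ⁴)»).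
PROVED for `e*_mod ≥ 3`, `ℓ ≥ 1` (for `e_u = 0` the left side is `log 0 = 0`). [claim: Joshi2024ATS4, status: disputed] -/
theorem lem6105_of_eq6106 (h3 : 3 ≤ T.estar) (hl : 1 ≤ T.l) (h : T.Eq6106) : T.Lem6105 := by
  intro u
  have he : (3 : ℝ) ≤ T.estar := by exact_mod_cast h3
  have hl' : (1 : ℝ) ≤ T.l := by exact_mod_cast hl
  have he0 : (0 : ℝ) < T.estar := by linarith
  have hl0 : (0 : ℝ) < T.l := by linarith
  -- «e ≤ 3 ≤ e*_mod»: `1 = log(exp 1) ≤ log 3 ≤ log e*_mod` (cf. `Literature.NumberTheory.Sieve.BetaSieve.one_le_log_three`)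
  have h3 : (1 : ℝ) ≤ Real.log 3 := by
    rw [← Real.log_exp 1]
    exact Real.log_le_log (Real.exp_pos 1) (by have := Real.exp_one_lt_d9; linarith)
  have hloge : 1 ≤ Real.log (T.estar : ℝ) := h3.trans (Real.log_le_log (by norm_num) he)
  have hlogl : 0 ≤ Real.log (T.l : ℝ) := Real.log_nonneg hl'
  have hprod : Real.log ((T.estar : ℝ) * T.l) = Real.log T.estar + Real.log T.l := Real.log_mul he0.ne' hl0.ne'
  rw [hprod]
  rcases Nat.eq_zero_or_pos (T.eM u) with h0 | hpos
  · simp only [h0, Nat.cast_zero, Real.log_zero]; linarith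
  · have hu : (0 : ℝ) < T.eM u := by exact_mod_cast hpos
    have h1 : Real.log (T.eM u) ≤ Real.log ((T.estar : ℝ) * (T.l : ℝ) ^ 4) := Real.log_le_log hu (h u)
    rw [Real.log_mul he0.ne' (pow_pos hl0 4).ne', Real.log_pow] at h1
    push_cast at h1
    linarith

end PrimeTowerDatum

end Summit.ABC.IUTFork.Joshi.ATS4

end
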